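import Mathlib
import HarnessLib
import Literature.MathematicalPhysics.QuantumLattice.FejerTopCutoff
import Summits.HubbardSuperconductivity.HubbardSuperconductivity.Theorems.KLProgrammeKLRegimeVolumeLimitOccupation

/-!
# The momentum two-point numerator at FINITE cutoff as a time-integral Fourier coefficient of the position-space two-point word
# (TAU-BRIDGE §3 (F) for the TWO-point function; seat hubbard-kl-k3c5-p2, g3, «analytic-continuation-free assembly via FinalTwoLegVolLimit»)

Route `KLProgramme`, gen-4 child 5 `KLRegimeVolumeLimitV12` (stmt-HubbardSuperconductivity-19858), stub `stub_vl_bound` via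
`stub_vl_bound_of_Z1_twoPoint` (`…VolumeLimitBoundGlueTwoPoint`, hypothesis `h2` = per-label limits of the bare carrier).  By g0's frame
reduction (`klSelfEnergy_nScales_succ_frame_reduction`) the bare VL carrier at label `k = (ω, p)` is an affine function of the momentum-space
two-point ratio `N_M(k,σ)/D_M`, `N_M(k,σ) = ∫dμ_{C_M} ψ̂⁺_{kσ}ψ̂⁻_{kσ} e^{−V}`.  This module writes `N_M` EXACTLY, at every finite `(L, M)` and
every coupling, as a time-integral Fourier coefficient of the position–time two-point word
`W_M(x,y,u) = ∫dμ_{C_M} ψ⁺_{(x,u)σ} ψ⁻_{(y,0)σ} e^{−V}` (BGM (2.5) fields `positionField`):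

* `positionField_mul_positionField_mul_eq_sum`, `twoPointWord_eq_sum` — mode expansion + the `U(1) × translation` selection rule
  (`gaussExpect_genPair_boltzmann_eq_zero_of_ne`, k3c5-p3): `W_M(x,y,u) = (βL²)⁻² Σ_k e^{iω_k u} χ_{k⃗}(x) conj χ_{k⃗}(y) · N_M(k,σ)`;
* `integral_cexp_neg_mul_cexp_matsubara` (`∫₀^β e^{−iω u}e^{iω' u} du = β[ω = ω']`, kept fermionic frequencies) and the kernel lemma
  `integral_sum_twoPointKernel_mul_modePhases`;
* **`genPair_mul_conj_torusChar_eq_integral_twoPointWord`**: `N_M(k,σ)·conj χ_{k⃗}(y) = βL² ∫₀^β Σ_z e^{−iω_k u} conj χ_{k⃗}(z) W_M(z,y,u) du`;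
* **`genPair_eq_integral_twoPointWord`** (`y = 0`): `N_M(k,σ) = βL² ∫₀^β Σ_z e^{−iω_k u} conj χ_{k⃗}(z) · W_M(z,0,u) du` — the same kernel as
  k3c5-p3's six-point form `sixPoint_up_eq_integral_word`;
* **`genPair_eq_integral_twoPointWord_two`** (double sum, no translation invariance used downstream):
  `N_M(k,σ) = β ∫₀^β Σ_z Σ_y e^{−iω_k u} conj χ_{k⃗}(z) χ_{k⃗}(y) · W_M(z,y,u) du`.

So at a FIXED Matsubara integer the `M → ∞` limit of `N_M/D_M` is a dominated-convergence question for `u ↦ W_M(z,y,u)/D_M` on `[0,β]`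
(k3c4-p2's `…MatsubaraWordL1`), and its identification is the Hamiltonian two-time function (k3c5-p1's (H1)) — the next file.
Everything is proved; no definition.
-/

noncomputable section

namespace Summit.HubbardSuperconductivity.HubbardSuperconductivity.Theorems.TwoPointAssembly

set_option linter.dupNamespace false -- summit = problem name (single-conjunct summit), D-0017

open Finset MeasureTheory intervalIntegral Literature.MathematicalPhysics.QuantumLattice Literature.Probability.LatticeModels GrassmannAlgebra
open scoped ComplexConjugate

variable {L M : ℕ} [NeZero L]

/-! ## §1 Phases: time orthogonality of two kept fermionic frequencies, the kernel against the mode phases -/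

omit [NeZero L] in
/-- `e^{−iω u} e^{iω' u} = e^{2πi (n' − n) u/β}` for kept frequencies `ω = π(2n+1)/β`, `ω' = π(2n'+1)/β` (`β ≠ 0`). -/
theorem cexp_neg_matsubara_mul_cexp_matsubara (β : ℝ) (ω ω' : MatsubaraIdx M) (u : ℝ) :
    Complex.exp (-(((matsubaraFreq β M ω * u : ℝ) : ℂ) * Complex.I)) * Complex.exp (((matsubaraFreq β M ω' * u : ℝ) : ℂ) * Complex.I) =
      Complex.exp (((2 * Real.pi * ((matsubaraInt M ω' - matsubaraInt M ω : ℤ) : ℝ) * u / β : ℝ) : ℂ) * Complex.I) := by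
  rw [← Complex.exp_add]
  congr 1
  simp only [matsubaraFreq]
  push_cast
  field_simp
  ring

omit [NeZero L] in
/-- **Time orthogonality** (`0 < β`): `∫₀^β e^{−iω u} e^{iω' u} du = β` if `ω' = ω` and `0` otherwise. -/
theorem integral_cexp_neg_mul_cexp_matsubara {β : ℝ} (hβ : 0 < β) (ω ω' : MatsubaraIdx M) :
    ∫ u in (0 : ℝ)..β, Complex.exp (-(((matsubaraFreq β M ω * u : ℝ) : ℂ) * Complex.I)) *
        Complex.exp (((matsubaraFreq β M ω' * u : ℝ) : ℂ) * Complex.I) =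
      if ω' = ω then (β : ℂ) else 0 := by
  simp_rw [cexp_neg_matsubara_mul_cexp_matsubara β ω ω']
  rw [intervalIntegral.integral_of_le hβ.le, ← integral_Icc_eq_integral_Ioc, integral_Icc_exp_freqTransfer hβ]
  by_cases h : ω' = ω
  · subst h; simp
  · rw [if_neg h, if_neg]
    intro h0
    exact h (matsubaraInt_injective M (by omega))

/-- **The kernel against the mode phases** (`0 < β`): for labels `k, k'` and a site `y`,
`∫₀^β Σ_z e^{−iω_k u} conj χ_{k⃗}(z) · (e^{iω_{k'} u} χ_{k⃗'}(z) conj χ_{k⃗'}(y)) du = βL²·[k' = k]·conj χ_{k⃗}(y)`. -/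
theorem integral_sum_twoPointKernel_mul_modePhases {β : ℝ} (hβ : 0 < β) (k k' : FreqMomentum L M) (y : TorusSite 2 L) :
    ∫ u in (0 : ℝ)..β, ∑ z : TorusSite 2 L,
        Complex.exp (-(((matsubaraFreq β M k.1 * u : ℝ) : ℂ) * Complex.I)) * conj (torusChar k.2 z) *
          (Complex.exp (((matsubaraFreq β M k'.1 * u : ℝ) : ℂ) * Complex.I) * torusChar k'.2 z * conj (torusChar k'.2 y)) =
      if k' = k then ((β * (L : ℝ) ^ 2 : ℝ) : ℂ) * conj (torusChar k.2 y) else 0 := by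
  -- separate the time factor from the site sum
  have hterm : ∀ u : ℝ, (∑ z : TorusSite 2 L,
      Complex.exp (-(((matsubaraFreq β M k.1 * u : ℝ) : ℂ) * Complex.I)) * conj (torusChar k.2 z) *
        (Complex.exp (((matsubaraFreq β M k'.1 * u : ℝ) : ℂ) * Complex.I) * torusChar k'.2 z * conj (torusChar k'.2 y))) =
      (Complex.exp (-(((matsubaraFreq β M k.1 * u : ℝ) : ℂ) * Complex.I)) *
          Complex.exp (((matsubaraFreq β M k'.1 * u : ℝ) : ℂ) * Complex.I)) *
        ((∑ z : TorusSite 2 L, torusChar (k'.2 - k.2) z) * conj (torusChar k'.2 y)) := by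
    intro u
    rw [Finset.sum_mul, Finset.mul_sum]
    refine Finset.sum_congr rfl fun z _ => ?_
    rw [torusChar_sub_left]
    ring
  simp_rw [hterm]
  rw [intervalIntegral.integral_mul_const, integral_cexp_neg_mul_cexp_matsubara hβ, sum_torusChar_right]
  by_cases h : k' = k
  · subst h
    simp only [if_true, sub_self]
    push_cast
    ring
  · rw [if_neg h]
    by_cases h1 : k'.1 = k.1
    · have h2 : k'.2 - k.2 ≠ 0 := fun h2 => h (Prod.ext h1 (sub_eq_zero.mp h2))
      rw [if_neg h2, zero_mul, mul_zero]
    · rw [if_neg h1, zero_mul]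

/-! ## §2 The position–time two-point word in momentum modes -/

/-- The product of two position–time fields against a cofactor, expanded in momentum modes:
`ψ⁺_{(x,s)σ}·ψ⁻_{(y,t)σ'}·E = Σ_k Σ_{k'} ((βL²)⁻² conj w⁰_k(x,s) conj w¹_{k'}(y,t)) • (ψ̂⁺_{kσ} ψ̂⁻_{k'σ'} E)`. -/
theorem positionField_mul_positionField_mul_eq_sum (β : ℝ) (σ σ' : Fin 2) (x y : TorusSite 2 L) (s t : ℝ) (E : HubbardGrassmann L M) :
    positionField L M β 0 σ x s * positionField L M β 1 σ' y t * E =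
      ∑ k : FreqMomentum L M, ∑ k' : FreqMomentum L M,
        ((((1 / (β * (L : ℝ) ^ 2) : ℝ) : ℂ)) ^ 2 * (conj (vertexPlaneWave L M β 0 k x s) * conj (vertexPlaneWave L M β 1 k' y t))) •
          (gen ℂ (((k, σ), 0) : HubbardFieldIdx L M) * gen ℂ (((k', σ'), 1) : HubbardFieldIdx L M) * E) := by
  rw [positionField, positionField, Finset.sum_mul, Finset.sum_mul]
  refine Finset.sum_congr rfl fun k _ => ?_
  rw [Finset.mul_sum, Finset.sum_mul]
  refine Finset.sum_congr rfl fun k' _ => ?_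
  rw [smul_mul_smul_comm, smul_mul_assoc]
  congr 1
  ring

/-- **THE TWO-POINT WORD IN MODES** (selection rule, every `U`): with `N_M(k,σ) = ∫dμ_{C_M} ψ̂⁺_{kσ}ψ̂⁻_{kσ}e^{−V}`,
`∫dμ_{C_M} ψ⁺_{(x,u)σ} ψ⁻_{(y,0)σ} e^{−V} = Σ_k (βL²)⁻² (e^{iω_k u} χ_{k⃗}(x) conj χ_{k⃗}(y)) · N_M(k,σ)`. -/
theorem twoPointWord_eq_sum (β U μ : ℝ) (σ : Fin 2) (x y : TorusSite 2 L) (u : ℝ) :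
    gaussExpect ℂ (hubbardCovariance L M β μ 0)
        (positionField L M β 0 σ x u * positionField L M β 1 σ y 0 * grassmannExp (-(hubbardInteraction L M β U))) =
      ∑ k : FreqMomentum L M, ((((1 / (β * (L : ℝ) ^ 2) : ℝ) : ℂ)) ^ 2 *
          (Complex.exp (((matsubaraFreq β M k.1 * u : ℝ) : ℂ) * Complex.I) * torusChar k.2 x * conj (torusChar k.2 y))) *
        gaussExpect ℂ (hubbardCovariance L M β μ 0)
          (gen ℂ (((k, σ), 0) : HubbardFieldIdx L M) * gen ℂ (((k, σ), 1) : HubbardFieldIdx L M) *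
            grassmannExp (-(hubbardInteraction L M β U))) := by
  rw [positionField_mul_positionField_mul_eq_sum, map_sum]
  refine Finset.sum_congr rfl fun k _ => ?_
  rw [map_sum]
  rw [Finset.sum_eq_single k]
  · rw [map_smul, smul_eq_mul, conj_vertexPlaneWave_zero_eq, conj_vertexPlaneWave_one_eq]
    simp only [mul_zero, Complex.ofReal_zero, zero_mul, neg_zero, Complex.exp_zero, one_mul]
  · intro k' _ hk'
    rw [map_smul, smul_eq_mul]
    have hne : ((k, σ) : FreqMomentum L M × Fin 2) ≠ (k', σ) := fun h => hk' (Prod.ext_iff.mp h).1.symm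
    rw [(gaussExpect_genPair_boltzmann_eq_zero_of_ne (L := L) (M := M) β U μ hne).1, mul_zero]
  · intro h; exact absurd (Finset.mem_univ k) h

/-- The two-point word is continuous in the time of the `ψ⁺` field (a trigonometric polynomial). -/
theorem continuous_twoPointWord (β U μ : ℝ) (σ : Fin 2) (x y : TorusSite 2 L) :
    Continuous fun u : ℝ => gaussExpect ℂ (hubbardCovariance L M β μ 0)
      (positionField L M β 0 σ x u * positionField L M β 1 σ y 0 * grassmannExp (-(hubbardInteraction L M β U))) := by
  simp_rw [twoPointWord_eq_sum]
  refine continuous_finsetSum _ fun k _ => ?_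
  fun_prop

/-! ## §3 The time-integral Fourier forms -/

/-- **`N_M(k,σ) · conj χ_{k⃗}(y) = βL² ∫₀^β Σ_z e^{−iω_k u} conj χ_{k⃗}(z) · W_M(z,y,u) du`** (`0 < β`, every `U`, every finite `(L, M)`,
every second site `y`). -/
theorem genPair_mul_conj_torusChar_eq_integral_twoPointWord {β : ℝ} (hβ : 0 < β) (U μ : ℝ) (σ : Fin 2) (k : FreqMomentum L M)
    (y : TorusSite 2 L) :
    gaussExpect ℂ (hubbardCovariance L M β μ 0)
          (gen ℂ (((k, σ), 0) : HubbardFieldIdx L M) * gen ℂ (((k, σ), 1) : HubbardFieldIdx L M) *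
            grassmannExp (-(hubbardInteraction L M β U))) * conj (torusChar k.2 y) =
      ((β * (L : ℝ) ^ 2 : ℝ) : ℂ) * ∫ u in (0 : ℝ)..β, ∑ z : TorusSite 2 L,
        Complex.exp (-(((matsubaraFreq β M k.1 * u : ℝ) : ℂ) * Complex.I)) * conj (torusChar k.2 z) *
          gaussExpect ℂ (hubbardCovariance L M β μ 0)
            (positionField L M β 0 σ z u * positionField L M β 1 σ y 0 * grassmannExp (-(hubbardInteraction L M β U))) := by
  have hβL : ((β * (L : ℝ) ^ 2 : ℝ) : ℂ) ≠ 0 := by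
    have hL : (L : ℝ) ≠ 0 := by exact_mod_cast NeZero.ne L
    exact_mod_cast mul_ne_zero hβ.ne' (pow_ne_zero 2 hL)
  set c : ℂ := ((β * (L : ℝ) ^ 2 : ℝ) : ℂ) with hc
  have hinv : (((1 / (β * (L : ℝ) ^ 2) : ℝ) : ℂ)) = c⁻¹ := by rw [hc]; push_cast; ring
  set N : FreqMomentum L M → ℂ := fun k' => gaussExpect ℂ (hubbardCovariance L M β μ 0)
    (gen ℂ (((k', σ), 0) : HubbardFieldIdx L M) * gen ℂ (((k', σ), 1) : HubbardFieldIdx L M) *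
      grassmannExp (-(hubbardInteraction L M β U))) with hN
  -- the phase function of one mode and the integrand as a mode sum
  set Φ : FreqMomentum L M → ℝ → ℂ := fun k' u => ∑ z : TorusSite 2 L,
    Complex.exp (-(((matsubaraFreq β M k.1 * u : ℝ) : ℂ) * Complex.I)) * conj (torusChar k.2 z) *
      (Complex.exp (((matsubaraFreq β M k'.1 * u : ℝ) : ℂ) * Complex.I) * torusChar k'.2 z * conj (torusChar k'.2 y)) with hΦ
  have hΦcont : ∀ k', Continuous (Φ k') := fun k' => by
    simp only [hΦ]
    refine continuous_finsetSum _ fun z _ => ?_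
    fun_prop
  have hint : ∀ u : ℝ, (∑ z : TorusSite 2 L,
      Complex.exp (-(((matsubaraFreq β M k.1 * u : ℝ) : ℂ) * Complex.I)) * conj (torusChar k.2 z) *
        gaussExpect ℂ (hubbardCovariance L M β μ 0)
          (positionField L M β 0 σ z u * positionField L M β 1 σ y 0 * grassmannExp (-(hubbardInteraction L M β U)))) =
      ∑ k' : FreqMomentum L M, Φ k' u * (c⁻¹ ^ 2 * N k') := by
    intro u
    simp_rw [twoPointWord_eq_sum, hinv, Finset.mul_sum]
    rw [Finset.sum_comm]
    refine Finset.sum_congr rfl fun k' _ => ?_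
    simp only [hΦ, hN, Finset.sum_mul]
    refine Finset.sum_congr rfl fun z _ => ?_
    ring
  simp_rw [hint]
  rw [intervalIntegral.integral_finsetSum (f := fun (k' : FreqMomentum L M) (u : ℝ) => Φ k' u * (c⁻¹ ^ 2 * N k'))
    fun k' _ => ((hΦcont k').mul continuous_const).intervalIntegrable _ _]
  simp_rw [intervalIntegral.integral_mul_const]
  have hΦint : ∀ k' : FreqMomentum L M, ∫ u in (0 : ℝ)..β, Φ k' u =
      if k' = k then c * conj (torusChar k.2 y) else 0 := fun k' => by
    simp only [hΦ, hc]
    exact integral_sum_twoPointKernel_mul_modePhases hβ k k' y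
  simp_rw [hΦint, ite_mul, zero_mul, Finset.sum_ite_eq', Finset.mem_univ, if_true]
  simp only [hN]
  field_simp

/-- **THE SINGLE-SUM FORM (F): `N_M(k,σ) = βL² ∫₀^β Σ_z e^{−iω_k u} conj χ_{k⃗}(z) · ∫dμ_{C_M} ψ⁺_{(z,u)σ}ψ⁻_{(0,0)σ}e^{−V} du`** (`0 < β`, every
`U`, `L`, `M`) — the kernel of k3c5-p3's `sixPoint_up_eq_integral_word`, for the TWO-point function. -/
theorem genPair_eq_integral_twoPointWord {β : ℝ} (hβ : 0 < β) (U μ : ℝ) (σ : Fin 2) (k : FreqMomentum L M) :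
    gaussExpect ℂ (hubbardCovariance L M β μ 0)
        (gen ℂ (((k, σ), 0) : HubbardFieldIdx L M) * gen ℂ (((k, σ), 1) : HubbardFieldIdx L M) *
          grassmannExp (-(hubbardInteraction L M β U))) =
      ((β * (L : ℝ) ^ 2 : ℝ) : ℂ) * ∫ u in (0 : ℝ)..β, ∑ z : TorusSite 2 L,
        Complex.exp (-(((matsubaraFreq β M k.1 * u : ℝ) : ℂ) * Complex.I)) * conj (torusChar k.2 z) *
          gaussExpect ℂ (hubbardCovariance L M β μ 0)
            (positionField L M β 0 σ z u * positionField L M β 1 σ 0 0 * grassmannExp (-(hubbardInteraction L M β U))) := by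
  have h := genPair_mul_conj_torusChar_eq_integral_twoPointWord hβ U μ σ k 0
  rwa [torusChar_zero_right, map_one, mul_one] at h

/-- **THE DOUBLE-SUM FORM: `N_M(k,σ) = β ∫₀^β Σ_z Σ_y e^{−iω_k u} conj χ_{k⃗}(z) χ_{k⃗}(y) · ∫dμ_{C_M} ψ⁺_{(z,u)σ}ψ⁻_{(y,0)σ}e^{−V} du`**
(`0 < β`, every `U`, `L`, `M`) — the form matching the Bloch-mode sums `c_{pσ} = L⁻¹Σ_y conj χ_p(y) c_{yσ}` of the Hamiltonian side without any
use of translation invariance. -/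
theorem genPair_eq_integral_twoPointWord_two {β : ℝ} (hβ : 0 < β) (U μ : ℝ) (σ : Fin 2) (k : FreqMomentum L M) :
    gaussExpect ℂ (hubbardCovariance L M β μ 0)
        (gen ℂ (((k, σ), 0) : HubbardFieldIdx L M) * gen ℂ (((k, σ), 1) : HubbardFieldIdx L M) *
          grassmannExp (-(hubbardInteraction L M β U))) =
      (β : ℂ) * ∫ u in (0 : ℝ)..β, ∑ z : TorusSite 2 L, ∑ y : TorusSite 2 L,
        Complex.exp (-(((matsubaraFreq β M k.1 * u : ℝ) : ℂ) * Complex.I)) * conj (torusChar k.2 z) * torusChar k.2 y *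
          gaussExpect ℂ (hubbardCovariance L M β μ 0)
            (positionField L M β 0 σ z u * positionField L M β 1 σ y 0 * grassmannExp (-(hubbardInteraction L M β U))) := by
  have hL0 : (L : ℂ) ≠ 0 := by exact_mod_cast NeZero.ne L
  have hL2 : ((L : ℂ) ^ 2) ≠ 0 := pow_ne_zero 2 hL0
  set N : ℂ := gaussExpect ℂ (hubbardCovariance L M β μ 0)
    (gen ℂ (((k, σ), 0) : HubbardFieldIdx L M) * gen ℂ (((k, σ), 1) : HubbardFieldIdx L M) *
      grassmannExp (-(hubbardInteraction L M β U))) with hN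
  set W : TorusSite 2 L → TorusSite 2 L → ℝ → ℂ := fun z y u => gaussExpect ℂ (hubbardCovariance L M β μ 0)
    (positionField L M β 0 σ z u * positionField L M β 1 σ y 0 * grassmannExp (-(hubbardInteraction L M β U))) with hW
  -- sum the `y`-resolved identity against `χ_{k⃗}(y)`
  have hy : ∀ y : TorusSite 2 L, N * conj (torusChar k.2 y) * torusChar k.2 y =
      ((β * (L : ℝ) ^ 2 : ℝ) : ℂ) * ((∫ u in (0 : ℝ)..β, ∑ z : TorusSite 2 L,
        Complex.exp (-(((matsubaraFreq β M k.1 * u : ℝ) : ℂ) * Complex.I)) * conj (torusChar k.2 z) * W z y u) * torusChar k.2 y) := by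
    intro y
    rw [hN, genPair_mul_conj_torusChar_eq_integral_twoPointWord hβ U μ σ k y, mul_assoc]
  have hyy : ∀ y : TorusSite 2 L, N * conj (torusChar k.2 y) * torusChar k.2 y = N := fun y => by
    rw [mul_assoc, mul_comm (conj _), torusChar_mul_conj, mul_one]
  have hsum : ∑ y : TorusSite 2 L, N * conj (torusChar k.2 y) * torusChar k.2 y = (L : ℂ) ^ 2 * N := by
    simp_rw [hyy]
    rw [Finset.sum_const, Finset.card_univ, nsmul_eq_mul]
    congr 1
    rw [Fintype.card_pi, prod_const, ZMod.card, card_univ, Fintype.card_fin]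
    push_cast
    ring
  -- continuity of the `y`-integrands (to swap the finite `y`-sum and the integral)
  have hcont : ∀ y : TorusSite 2 L, Continuous fun u : ℝ => ∑ z : TorusSite 2 L,
      Complex.exp (-(((matsubaraFreq β M k.1 * u : ℝ) : ℂ) * Complex.I)) * conj (torusChar k.2 z) * torusChar k.2 y * W z y u := by
    intro y
    refine continuous_finsetSum _ fun z _ => ?_
    have hw : Continuous fun u : ℝ => W z y u := by rw [hW]; exact continuous_twoPointWord β U μ σ z y
    fun_prop
  have hrhs : (∫ u in (0 : ℝ)..β, ∑ z : TorusSite 2 L, ∑ y : TorusSite 2 L,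
      Complex.exp (-(((matsubaraFreq β M k.1 * u : ℝ) : ℂ) * Complex.I)) * conj (torusChar k.2 z) * torusChar k.2 y * W z y u) =
      ∑ y : TorusSite 2 L, (∫ u in (0 : ℝ)..β, ∑ z : TorusSite 2 L,
        Complex.exp (-(((matsubaraFreq β M k.1 * u : ℝ) : ℂ) * Complex.I)) * conj (torusChar k.2 z) * W z y u) * torusChar k.2 y := by
    have hswap : (fun u : ℝ => ∑ z : TorusSite 2 L, ∑ y : TorusSite 2 L,
        Complex.exp (-(((matsubaraFreq β M k.1 * u : ℝ) : ℂ) * Complex.I)) * conj (torusChar k.2 z) * torusChar k.2 y * W z y u) =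
        fun u : ℝ => ∑ y : TorusSite 2 L, ∑ z : TorusSite 2 L,
          Complex.exp (-(((matsubaraFreq β M k.1 * u : ℝ) : ℂ) * Complex.I)) * conj (torusChar k.2 z) * torusChar k.2 y * W z y u :=
      funext fun u => Finset.sum_comm
    rw [hswap]
    rw [intervalIntegral.integral_finsetSum (f := fun (y : TorusSite 2 L) (u : ℝ) => ∑ z : TorusSite 2 L,
      Complex.exp (-(((matsubaraFreq β M k.1 * u : ℝ) : ℂ) * Complex.I)) * conj (torusChar k.2 z) * torusChar k.2 y * W z y u)
      fun y _ => (hcont y).intervalIntegrable _ _]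
    refine Finset.sum_congr rfl fun y _ => ?_
    rw [← intervalIntegral.integral_mul_const]
    congr 1
    funext u
    rw [Finset.sum_mul]
    refine Finset.sum_congr rfl fun z _ => ?_
    ring
  rw [hrhs]
  have hfin : (β : ℂ) * ∑ y : TorusSite 2 L, (∫ u in (0 : ℝ)..β, ∑ z : TorusSite 2 L,
      Complex.exp (-(((matsubaraFreq β M k.1 * u : ℝ) : ℂ) * Complex.I)) * conj (torusChar k.2 z) * W z y u) * torusChar k.2 y =
      ((L : ℂ) ^ 2)⁻¹ * ∑ y : TorusSite 2 L, N * conj (torusChar k.2 y) * torusChar k.2 y := by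
    simp_rw [hy]
    rw [← Finset.mul_sum, ← mul_assoc]
    congr 1
    push_cast
    field_simp
  rw [hfin, hsum, ← mul_assoc, inv_mul_cancel₀ hL2, one_mul]

end Summit.HubbardSuperconductivity.HubbardSuperconductivity.Theorems.TwoPointAssembly

end
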